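import Summits.QuantumFields.YangMills.Theorems.IR.VacuumEscapeCheegerSpectral
import Literature.Analysis.OperatorTheory.PositiveKernelTransferOperator
import Literature.Analysis.OperatorTheory.PositivityImproving
import HarnessLib

/-!
# Crux `IR` (stmt-QuantumFields-19354), line `ym-ir7-volume-monotone-gap` (ideator ym-ir-idea-7), input T-GAP-FINITE-sc —
# part 1a: sequence, arithmetic and `L²` lemmas for the lag-one covariance floor (abstract transfer operators)

Helper module for item `stmt-QuantumFields-19354` (`--supports … --as helper`; it closes nothing by itself).  Pooled prover
ym-ir-line-pool-p3 (g5).  Abstract setting of the tree's transfer-operator toolkit (`Literature/Analysis/OperatorTheory`): a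
probability space `(X, μ)`, a bounded symmetric strongly measurable kernel `K`, its `L²` operator `A` (`A φ =ᵐ ∫ K(·,y) φ(y)`),
a countable Hilbert basis of eigenvectors `A bᵢ = λᵢ bᵢ` with `0 ≤ λᵢ ≤ λ_{i₀}`, `0 < λ_{i₀}`, and a bounded measurable one-site
weight `f` (`|f| ≤ p`).  Writing `rᵢ = λᵢ/λ_{i₀}`, `x_s = Σ_{i ≠ i₀} rᵢ^s` (the trace excess of the chain of period `s`),
`ψ =ᵐ f·b_{i₀} ∈ L²`, `c_j = ⟪b_j, ψ⟫` and `V = ⟪ψ, Aψ⟫/λ_{i₀} − c_{i₀}² = Σ_{j ≠ i₀} r_j c_j²` (the lag-one "vacuum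
covariance" of `f`), this file PROVES

* `offTop_weighted_le`, `div_pow_le_offTop` — the Jensen-free Hölder step on sequences: `V ≤ x_s^{1/s} · Σ_{j≠i₀} c_j²`, hence
  `(V/p²)^s ≤ x_s` for every `s ≥ 1` (each off-top ratio satisfies `r_j ≤ x_s^{1/s}`);
* `hasSum_lam_mul_inner_sq` — `⟪φ, Aφ⟫ = Σ_j λ_j ⟪b_j, φ⟫²` (Parseval + symmetry), with the bounds `0 ≤ ⟪φ, Aφ⟫ ≤ λ_{i₀}‖φ‖²`;
* `exists_Lp_mul` and the matrix elements of `ψ =ᵐ f·φ` (`inner_mulLp_eq`, `inner_mulLp_apply_eq`, `norm_sq_mulLp_le`);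
* `cov_sub_le_of_bounds` — the thermal arithmetic turning a torus covariance minus trace-excess corrections into a vacuum floor.
The two abstract theorems S1 (`(V/p²)^s ≤ x_s`) and S2 (torus lag-one covariance `≤ V + 3p² x_t + p² x_{t−1}`) are in part 1b
(`VolumeMonotoneSpectralFloor.lean`).

Consumers: part 2 (`VolumeMonotoneTraceExcessFloor`) feeds the tree's volume-uniform strong-coupling facing-plaquette floor
(`SCFloor.facingPlaquetteCorr_floor_latticeRep`) and cold-pressure bound (`coldPressureBound_strongCoupling_log`) through S2 and S1 to
get `traceExcess r.ρ β (2S+1) (m+2) ≥ (c′β⁴)^{m+2}` on the engine window — the content of the line's input `TraceExcessFloorSC`.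

HONEST FRAMING: operator-theoretic bookkeeping; nothing here bears on weak coupling, `BalabanLadder.IR`, or the Yang–Mills mass gap
(Clay); R4 of the ladder closes only the conditional finite-𝕋⁴ rung `BalabanLadder.UV`.
Refs: M. Reed, B. Simon, *Methods of Modern Mathematical Physics I*, Thm. VI.22–23 (Hilbert–Schmidt eigen-expansion); I. Montvay,
G. Münster, *Quantum Fields on a Lattice* (1994), §1.5.2 (1.195)–(1.196) (transfer-matrix form of periodic-lattice correlators).
-/

set_option autoImplicit false

noncomputable section

open MeasureTheory Filter Set Function
open scoped RealInnerProductSpace ENNReal Topology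
open Literature.Analysis.OperatorTheory
open Summit.QuantumFields.YangMills.Cruxes.IR.VacuumEscape.Spectral
  (hasSum_cyclic_insert_fg inner_fgOp_eq inner_fgOp_one_eq stronglyMeasurable_fgKernel norm_fgKernel_le)

namespace Summit.QuantumFields.YangMills.Cruxes.IR.VolumeMonotone.SpectralFloor

/-! ## §1 Sequences: off-top sums and the Jensen-free Hölder step -/

section Sequences

variable {ι : Type*} [DecidableEq ι] {i₀ : ι}

/-- A term off the top index of a non-negative family is below the off-top sum. [folklore] -/
theorem le_of_hasSum_update {u : ι → ℝ} (hu : ∀ j, 0 ≤ u j) {x : ℝ} (hx : HasSum (update u i₀ 0) x)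
    {j : ι} (hj : j ≠ i₀) : u j ≤ x := by
  have h := le_hasSum hx j (fun k _ => ?_)
  · rwa [update_of_ne hj] at h
  · rcases eq_or_ne k i₀ with rfl | hk
    · rw [update_self]
    · rw [update_of_ne hk]; exact hu k

/-- The off-top sum of a non-negative family is non-negative. [folklore] -/
theorem nonneg_of_hasSum_update {u : ι → ℝ} (hu : ∀ j, 0 ≤ u j) {x : ℝ} (hx : HasSum (update u i₀ 0) x) :
    0 ≤ x :=
  hx.nonneg fun k => by
    rcases eq_or_ne k i₀ with rfl | hk
    · rw [update_self]
    · rw [update_of_ne hk]; exact hu k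

/-- **The Jensen-free Hölder step.**  For non-negative `r, w` and `s ≥ 1`: every off-top ratio satisfies `r_j^s ≤ x_s`, hence
`r_j ≤ x_s^{1/s}`, so `Σ_{j≠i₀} r_j w_j ≤ x_s^{1/s} Σ_{j≠i₀} w_j`. [folklore] -/
theorem offTop_weighted_le {r w : ι → ℝ} (hr : ∀ j, 0 ≤ r j) (hw : ∀ j, 0 ≤ w j) {s : ℕ} (hs : s ≠ 0)
    {x W V : ℝ} (hx : HasSum (update (fun j => r j ^ s) i₀ 0) x) (hW : HasSum (update w i₀ 0) W)
    (hV : HasSum (update (fun j => r j * w j) i₀ 0) V) : V ≤ x ^ (s : ℝ)⁻¹ * W := by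
  have hroot : ∀ j, j ≠ i₀ → r j ≤ x ^ (s : ℝ)⁻¹ := fun j hj => by
    have h1 : r j ^ s ≤ x := le_of_hasSum_update (fun k => pow_nonneg (hr k) _) hx hj
    calc r j = (r j ^ s) ^ (s : ℝ)⁻¹ := (Real.pow_rpow_inv_natCast (hr j) hs).symm
      _ ≤ x ^ (s : ℝ)⁻¹ := Real.rpow_le_rpow (pow_nonneg (hr j) _) h1 (by positivity)
  have hle : ∀ j, update (fun j => r j * w j) i₀ 0 j ≤ x ^ (s : ℝ)⁻¹ * update w i₀ 0 j := fun j => by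
    rcases eq_or_ne j i₀ with rfl | hj
    · rw [update_self, update_self, mul_zero]
    · rw [update_of_ne hj, update_of_ne hj]
      exact mul_le_mul_of_nonneg_right (hroot j hj) (hw j)
  exact hasSum_le hle hV (hW.mul_left _)

/-- **Off-top power bound**: with `Σ_{j≠i₀} w_j ≤ P`, `(V/P)^s ≤ x_s` (`V = Σ_{j≠i₀} r_j w_j`, `x_s = Σ_{j≠i₀} r_j^s`). [folklore] -/
theorem div_pow_le_offTop {r w : ι → ℝ} (hr : ∀ j, 0 ≤ r j) (hw : ∀ j, 0 ≤ w j) {s : ℕ} (hs : s ≠ 0)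
    {x W V P : ℝ} (hx : HasSum (update (fun j => r j ^ s) i₀ 0) x) (hW : HasSum (update w i₀ 0) W)
    (hV : HasSum (update (fun j => r j * w j) i₀ 0) V) (hP : 0 < P) (hWP : W ≤ P) : (V / P) ^ s ≤ x := by
  have hx0 : 0 ≤ x := nonneg_of_hasSum_update (fun k => pow_nonneg (hr k) _) hx
  have hV0 : 0 ≤ V := nonneg_of_hasSum_update (fun k => mul_nonneg (hr k) (hw k)) hV
  have h1 : V ≤ x ^ (s : ℝ)⁻¹ * P :=
    (offTop_weighted_le hr hw hs hx hW hV).trans (mul_le_mul_of_nonneg_left hWP (Real.rpow_nonneg hx0 _))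
  have h2 : V / P ≤ x ^ (s : ℝ)⁻¹ := by rwa [div_le_iff₀ hP]
  calc (V / P) ^ s ≤ (x ^ (s : ℝ)⁻¹) ^ s := pow_le_pow_left₀ (div_nonneg hV0 hP.le) h2 s
    _ = x := Real.rpow_inv_natCast_pow hx0 hs

/-- Off-top sums with bounded coefficients: `|Σ_{j≠i₀} u_j d_j| ≤ p · Σ_{j≠i₀} u_j` for `u ≥ 0`, `|d| ≤ p`. [folklore] -/
theorem abs_offTop_mul_le {u d : ι → ℝ} (hu : ∀ j, 0 ≤ u j) {p : ℝ} (hd : ∀ j, |d j| ≤ p) {x E : ℝ}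
    (hx : HasSum (update u i₀ 0) x) (hE : HasSum (update (fun j => u j * d j) i₀ 0) E) : |E| ≤ p * x := by
  have hup : ∀ j, update (fun j => u j * d j) i₀ 0 j ≤ p * update u i₀ 0 j := fun j => by
    rcases eq_or_ne j i₀ with rfl | hj
    · rw [update_self, update_self, mul_zero]
    · rw [update_of_ne hj, update_of_ne hj, mul_comm p]
      exact mul_le_mul_of_nonneg_left (le_of_abs_le (hd j)) (hu j)
  have hlo : ∀ j, -p * update u i₀ 0 j ≤ update (fun j => u j * d j) i₀ 0 j := fun j => by
    rcases eq_or_ne j i₀ with rfl | hj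
    · rw [update_self, update_self, mul_zero]
    · rw [update_of_ne hj, update_of_ne hj]
      have := mul_le_mul_of_nonneg_left (neg_le_of_abs_le (hd j)) (hu j)
      linarith
  have h1 : E ≤ p * x := hasSum_le hup hE (hx.mul_left p)
  have h2 : -p * x ≤ E := hasSum_le hlo (hx.mul_left (-p)) hE
  rw [abs_le]
  exact ⟨by linarith, h1⟩

/-- Off-top sums with bounded non-negative coefficients: `Σ_{j≠i₀} u_j q_j ≤ Q · Σ_{j≠i₀} u_j` for `u ≥ 0`, `q ≤ Q`. [folklore] -/
theorem offTop_mul_le {u q : ι → ℝ} (hu : ∀ j, 0 ≤ u j) {Q : ℝ} (hq : ∀ j, j ≠ i₀ → q j ≤ Q) {x E : ℝ}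
    (hx : HasSum (update u i₀ 0) x) (hE : HasSum (update (fun j => u j * q j) i₀ 0) E) : E ≤ Q * x := by
  have hup : ∀ j, update (fun j => u j * q j) i₀ 0 j ≤ Q * update u i₀ 0 j := fun j => by
    rcases eq_or_ne j i₀ with rfl | hj
    · rw [update_self, update_self, mul_zero]
    · rw [update_of_ne hj, update_of_ne hj, mul_comm Q]
      exact mul_le_mul_of_nonneg_left (hq j hj) (hu j)
  exact hasSum_le hup hE (hx.mul_left Q)

end Sequences

/-! ## §2 The thermal arithmetic: a torus covariance minus trace-excess corrections is below the vacuum covariance -/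

/-- **Thermal bookkeeping (pure real arithmetic).**  With `Z = 1 + x`, `x, x' ≥ 0`, `J = d₀ + E`, `|d₀| ≤ p`, `|E| ≤ p x`,
`I ≤ d₀² + V + p² x'` and `V ≥ 0`: `I/Z − (J/Z)² − 3p² x − p² x' ≤ V`. [folklore] -/
theorem cov_sub_le_of_bounds {I J Z x x' d₀ E V p : ℝ} (hZ : Z = 1 + x) (hx : 0 ≤ x) (hx' : 0 ≤ x')
    (hd : |d₀| ≤ p) (hE : |E| ≤ p * x) (hJ : J = d₀ + E) (hI : I ≤ d₀ ^ 2 + V + p ^ 2 * x') (hV : 0 ≤ V) :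
    I / Z - (J / Z) ^ 2 - 3 * p ^ 2 * x - p ^ 2 * x' ≤ V := by
  have hp : 0 ≤ p := (abs_nonneg _).trans hd
  have hZ1 : 1 ≤ Z := by rw [hZ]; linarith
  have hZ0 : 0 < Z := lt_of_lt_of_le one_pos hZ1
  have hd2 : d₀ ^ 2 ≤ p ^ 2 := by
    have := abs_le.1 hd
    nlinarith
  have hdE : -(p * (p * x)) ≤ d₀ * E := by
    have h1 : |d₀ * E| ≤ p * (p * x) := by
      rw [abs_mul]; exact mul_le_mul hd hE (abs_nonneg _) hp
    exact (abs_le.1 h1).1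
  -- the numerator `n = 2 d₀ E + E² − d₀² x ≥ −3 p² x`
  set n : ℝ := 2 * (d₀ * E) + E ^ 2 - d₀ ^ 2 * x with hn
  have hn3 : -(3 * p ^ 2 * x) ≤ n := by
    have hE2 : 0 ≤ E ^ 2 := sq_nonneg _
    have h3 : d₀ ^ 2 * x ≤ p ^ 2 * x := mul_le_mul_of_nonneg_right hd2 hx
    rw [hn]; nlinarith
  -- `J²/Z − d₀² = n / Z ≥ −3 p² x`
  have hJZ : J ^ 2 / Z - d₀ ^ 2 = n / Z := by
    rw [hJ, hn, eq_div_iff hZ0.ne']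
    field_simp
    rw [hZ]; ring
  have hnZ : -(3 * p ^ 2 * x) ≤ n / Z := by
    rcases le_or_gt 0 n with h0 | h0
    · exact le_trans (by nlinarith) (div_nonneg h0 hZ0.le)
    · have : n ≤ n / Z := by
        rw [le_div_iff₀ hZ0]; nlinarith
      linarith
  -- the covariance identity `I = Z · Cov + J²/Z`
  set Cov : ℝ := I / Z - (J / Z) ^ 2 with hCov
  have hIeq : I = Z * Cov + J ^ 2 / Z := by
    rw [hCov]; field_simp; ring
  rcases le_or_gt Cov 0 with hc | hc
  · -- non-positive covariance: the claim is trivial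
    have : Cov - 3 * p ^ 2 * x - p ^ 2 * x' ≤ 0 := by nlinarith
    linarith
  · -- positive covariance: `Z·Cov ≥ Cov`
    have hZC : Cov ≤ Z * Cov := le_mul_of_one_le_left hc.le hZ1
    have hV' : Z * Cov + J ^ 2 / Z - d₀ ^ 2 - p ^ 2 * x' ≤ V := by rw [← hIeq]; linarith
    have : Cov + (J ^ 2 / Z - d₀ ^ 2) - p ^ 2 * x' ≤ V := by linarith
    rw [hJZ] at this
    linarith

/-! ## §3 Hilbert space: quadratic forms of an eigenbasis operator -/

section Hilbert

variable {E : Type*} [NormedAddCommGroup E] [InnerProductSpace ℝ E] [CompleteSpace E] {ι : Type*}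
  {A : E →L[ℝ] E} {b : HilbertBasis ι ℝ E} {lam : ι → ℝ}

/-- **Parseval for the quadratic form**: `⟪φ, Aφ⟫ = Σ_j λ_j ⟪b_j, φ⟫²` for a self-adjoint `A` with eigenbasis `b`. [folklore] -/
theorem hasSum_lam_mul_inner_sq (hsa : IsSelfAdjoint A) (hb : ∀ i, A (b i) = lam i • b i) (φ : E) :
    HasSum (fun j => lam j * ⟪b j, φ⟫ ^ 2) ⟪φ, A φ⟫ := by
  have hsym := (ContinuousLinearMap.isSelfAdjoint_iff_isSymmetric.1 hsa)
  refine (b.hasSum_inner_mul_inner φ (A φ)).congr_fun fun j => ?_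
  have h1 : ⟪b j, A φ⟫ = lam j * ⟪b j, φ⟫ := by
    have h2 : ⟪A (b j), φ⟫ = ⟪b j, A φ⟫ := hsym (b j) φ
    rw [← h2, hb j, real_inner_smul_left]
  rw [h1, real_inner_comm φ (b j), sq]
  ring

omit [CompleteSpace E] in
/-- Parseval: `‖φ‖² = Σ_j ⟪b_j, φ⟫²`. [folklore] -/
theorem hasSum_inner_sq (b : HilbertBasis ι ℝ E) (φ : E) : HasSum (fun j => ⟪b j, φ⟫ ^ 2) (‖φ‖ ^ 2) := by
  have h := b.hasSum_inner_mul_inner φ φ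
  rw [real_inner_self_eq_norm_sq] at h
  exact h.congr_fun fun j => by rw [real_inner_comm φ (b j), sq]

/-- The quadratic form of a non-negative eigenbasis operator is non-negative and at most `λ_max ‖φ‖²`. [folklore] -/
theorem inner_apply_nonneg_le (hsa : IsSelfAdjoint A) (hb : ∀ i, A (b i) = lam i • b i)
    (hlam0 : ∀ i, 0 ≤ lam i) {Λ : ℝ} (hle : ∀ i, lam i ≤ Λ) (φ : E) :
    0 ≤ ⟪φ, A φ⟫ ∧ ⟪φ, A φ⟫ ≤ Λ * ‖φ‖ ^ 2 := by
  have h := hasSum_lam_mul_inner_sq hsa hb φ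
  refine ⟨h.nonneg fun j => mul_nonneg (hlam0 j) (sq_nonneg _), ?_⟩
  exact hasSum_le (fun j => mul_le_mul_of_nonneg_right (hle j) (sq_nonneg _)) h ((hasSum_inner_sq b φ).mul_left Λ)

end Hilbert

/-! ## §4 `L²` realisation: the vector `f·φ` and its matrix elements -/

section L2

variable {X : Type*} [MeasurableSpace X] {μ : Measure X} [IsProbabilityMeasure μ]

omit [IsProbabilityMeasure μ] in
/-- A bounded measurable weight times an `L²` function is (represented by) an `L²` function. [folklore] -/
theorem exists_Lp_mul {f : X → ℝ} (hf : Measurable f) {p : ℝ} (hfp : ∀ x, ‖f x‖ ≤ p) (φ : Lp ℝ 2 μ) :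
    ∃ ψ : Lp ℝ 2 μ, (ψ : X → ℝ) =ᵐ[μ] fun x => f x * φ x := by
  have hmem : MemLp (fun x => f x * φ x) 2 μ :=
    MemLp.of_le_mul (c := p) (Lp.memLp φ) (hf.aestronglyMeasurable.mul (Lp.aestronglyMeasurable φ))
      (Eventually.of_forall fun x => by
        rw [norm_mul]; exact mul_le_mul_of_nonneg_right (hfp x) (norm_nonneg _))
  exact ⟨hmem.toLp _, hmem.coeFn_toLp⟩

omit [IsProbabilityMeasure μ] in
/-- Matrix elements of `ψ =ᵐ f·φ` against `L²` vectors: `⟪χ, ψ⟫ = ∫ χ f φ`. [folklore] -/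
theorem inner_mulLp_eq {f : X → ℝ} {φ ψ : Lp ℝ 2 μ} (hψ : (ψ : X → ℝ) =ᵐ[μ] fun x => f x * φ x) (χ : Lp ℝ 2 μ) :
    ⟪χ, ψ⟫ = ∫ x, χ x * (f x * φ x) ∂μ := by
  rw [inner_eq_integral]
  refine integral_congr_ae ?_
  filter_upwards [hψ] with x hx
  rw [hx]

omit [IsProbabilityMeasure μ] in
/-- `‖ψ‖² ≤ p² ‖φ‖²` for `ψ =ᵐ f·φ`, `|f| ≤ p`. [folklore] -/
theorem norm_sq_mulLp_le {f : X → ℝ} {p : ℝ} (hfp : ∀ x, ‖f x‖ ≤ p) {φ ψ : Lp ℝ 2 μ}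
    (hψ : (ψ : X → ℝ) =ᵐ[μ] fun x => f x * φ x) : ‖ψ‖ ^ 2 ≤ p ^ 2 * ‖φ‖ ^ 2 := by
  rw [← real_inner_self_eq_norm_sq ψ, ← real_inner_self_eq_norm_sq φ, inner_eq_integral, inner_eq_integral,
    ← integral_const_mul]
  refine integral_mono_ae (integrable_mul ψ ψ) ((integrable_mul φ φ).const_mul _) ?_
  filter_upwards [hψ] with x hx
  rw [hx]
  have h1 : f x ^ 2 ≤ p ^ 2 := by
    have := hfp x
    rw [Real.norm_eq_abs] at this
    exact sq_le_sq' (abs_le.1 this).1 (abs_le.1 this).2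
  nlinarith [sq_nonneg (φ x), mul_le_mul_of_nonneg_right h1 (sq_nonneg ((φ : X → ℝ) x))]

variable {K : X → X → ℝ} {A : Lp ℝ 2 μ →L[ℝ] Lp ℝ 2 μ}

omit [IsProbabilityMeasure μ] in
/-- The quadratic form at `ψ =ᵐ f·φ` as a kernel double integral: `⟪ψ, Aψ⟫ = ∫ f φ · κ(f φ)`. [folklore] -/
theorem inner_mulLp_apply_eq (hA : ∀ φ : Lp ℝ 2 μ, (A φ : X → ℝ) =ᵐ[μ] fun x => ∫ y, K x y * φ y ∂μ)
    {f : X → ℝ} {φ ψ : Lp ℝ 2 μ} (hψ : (ψ : X → ℝ) =ᵐ[μ] fun x => f x * φ x) :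
    ⟪ψ, A ψ⟫ = ∫ x, f x * φ x * ∫ y, K x y * (f y * φ y) ∂μ ∂μ := by
  rw [inner_kernelOp_eq_integral hA ψ ψ]
  have hin : ∀ x, ∫ y, K x y * ψ y ∂μ = ∫ y, K x y * (f y * φ y) ∂μ := fun x =>
    integral_congr_ae (by filter_upwards [hψ] with y hy; rw [hy])
  refine integral_congr_ae ?_
  filter_upwards [hψ] with x hx
  rw [hx, hin x]

end L2

end Summit.QuantumFields.YangMills.Cruxes.IR.VolumeMonotone.SpectralFloor

end
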